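import Literature.NumberTheory.Transcendental.RoySmallValueDecomposition
import Literature.NumberTheory.Transcendental.RoySmallValueLineForms
import Mathlib.Algebra.MvPolynomial.NoZeroDivisors
import HarnessLib

/-!
# Roy's small value estimate for `𝔾ₐ × 𝔾ₘ` — the ideal `(P, Q)`: Hilbert function and zeros

Topic `Literature/NumberTheory/Transcendental`. Part of the formalisation of the proof of Roy 2013,
Theorem 1.1 (named fact `roy2013_thm_1_1`, `RoySmallValueEstimates.lean`). Source: D. Roy,
*A small value estimate for `𝔾ₐ × 𝔾ₘ`*, Mathematika 59 (2013) 333–363 = arXiv:1301.0663, §5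
(Lemma 5.1 and its proof, p. 13) and §6 (proof of Proposition 6.4, p. 17):

> (ii) for `i = 1, …, t`, we have `dim_ℂ (P₁, …, Pᵢ)_D = Σ_{j=1}^{i} (−1)^{j−1} binom(i, j)
> binom(D − jd + m, m)` [...]
> Then `𝒵(P, Q)` has dimension `0` [...]

For two coprime ternary forms `P, Q` of degree `D` (coprime = `Q` is a non-zero-divisor modulo
`P`) we prove: the degree-`ν` part of `(P, Q)` has dimension `2 s(ν−D) − s(ν−2D)`
(`s(n) = binom(n+2, 2)`), so that `ℂ[X]_ν/(P, Q)_ν` has dimension `D²` for `ν ≥ 2D`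
(`finrank_pieceSup_add_sq`); distinct points impose independent conditions on forms of large
degree, whence **`𝒵(P, Q)` consists of at most `D²` projective points** (`card_common_zeros_le`,
`exists_common_zero_reprs`); consequently some line `X₀ = aX₁ + bX₂` avoids `𝒵(P, Q)` and its
`D`-th power is a form of degree `D` which is a non-zero-divisor modulo `(P, Q)`
(`exists_regular_lineForm_pow`) — the regular sequence `(P, Q, R₀)` that Lemma 5.1 / Theorem 5.2
start from. Everything here is proved; no named facts.

## References

* [Roy2013] D. Roy, *A small value estimate for 𝔾ₐ × 𝔾ₘ*, Mathematika 59 (2013), 333–363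
  (arXiv:1301.0663), §5, Lemma 5.1; §6, proof of Proposition 6.4.
-/

noncomputable section

open MvPolynomial Finset Module

namespace Literature.NumberTheory.Transcendental

namespace Roy2013

/-! ### The Hilbert function of `(P, Q)` -/

/-- `P·ℂ[X]_n ∩ Q·ℂ[X]_n = PQ·ℂ[X]_{n−D}` for `n ≥ D` (`Q` a non-zero-divisor mod `P`).
[cite: Roy2013, §5, proof of Lemma 5.1] -/
theorem map_mulLeft_inf_map_mulLeft_of_le {P Q : CX} {D n : ℕ} (hP : P.IsHomogeneous D)
    (hQ : Q.IsHomogeneous D) (hPQ : ∀ f : CX, Q * f ∈ Ideal.span {P} → f ∈ Ideal.span {P})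
    (hDn : D ≤ n) :
    (homogeneousSubmodule (Fin 3) ℂ n).map (LinearMap.mulLeft ℂ P) ⊓
        (homogeneousSubmodule (Fin 3) ℂ n).map (LinearMap.mulLeft ℂ Q) =
      (homogeneousSubmodule (Fin 3) ℂ (n - D)).map (LinearMap.mulLeft ℂ (P * Q)) := by
  apply le_antisymm
  · rintro f ⟨⟨a, ha, rfl⟩, ⟨b, hb, hab⟩⟩
    rw [LinearMap.mulLeft_apply, LinearMap.mulLeft_apply] at hab
    have hbP : b ∈ Ideal.span {P} := hPQ b (Ideal.mem_span_singleton'.mpr ⟨a, by rw [hab]; ring⟩)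
    obtain ⟨c, hc, hcb⟩ := mem_map_mulLeft_of_mem_span_singleton hP hDn hb hbP
    refine ⟨c, hc, ?_⟩
    simp only [LinearMap.mulLeft_apply] at hcb ⊢
    rw [← hab, ← hcb]; ring
  · rintro _ ⟨c, hc, rfl⟩
    refine ⟨⟨Q * c, ?_, ?_⟩, ⟨P * c, ?_, ?_⟩⟩
    · have h := hQ.mul hc; rwa [Nat.add_sub_cancel' hDn] at h
    · rw [LinearMap.mulLeft_apply, LinearMap.mulLeft_apply]; ring
    · have h := hP.mul hc; rwa [Nat.add_sub_cancel' hDn] at h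
    · rw [LinearMap.mulLeft_apply, LinearMap.mulLeft_apply]; ring

/-- `P·ℂ[X]_n ∩ Q·ℂ[X]_n = 0` for `n < D`. [cite: Roy2013, §5, proof of Lemma 5.1] -/
theorem map_mulLeft_inf_map_mulLeft_of_lt {P Q : CX} {D n : ℕ} (hP : P.IsHomogeneous D)
    (hP0 : P ≠ 0) (hPQ : ∀ f : CX, Q * f ∈ Ideal.span {P} → f ∈ Ideal.span {P}) (hn : n < D) :
    (homogeneousSubmodule (Fin 3) ℂ n).map (LinearMap.mulLeft ℂ P) ⊓
        (homogeneousSubmodule (Fin 3) ℂ n).map (LinearMap.mulLeft ℂ Q) = ⊥ := by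
  rw [eq_bot_iff]
  rintro f ⟨⟨a, ha, rfl⟩, ⟨b, hb, hab⟩⟩
  rw [LinearMap.mulLeft_apply, LinearMap.mulLeft_apply] at hab
  have hbP : b ∈ Ideal.span {P} := hPQ b (Ideal.mem_span_singleton'.mpr ⟨a, by rw [hab]; ring⟩)
  obtain ⟨c, rfl⟩ := Ideal.mem_span_singleton'.mp hbP
  rw [Submodule.mem_bot, LinearMap.mulLeft_apply, ← hab]
  by_cases hc : c = 0
  · rw [hc, zero_mul, mul_zero]
  · exfalso
    have hb0 : c * P ≠ 0 := mul_ne_zero hc hP0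
    have h1 := (mem_homogeneousSubmodule _ _).mp hb |>.totalDegree hb0
    rw [totalDegree_mul_of_isDomain hc hP0, hP.totalDegree hP0] at h1
    omega

/-- **`dim (P, Q)_{n+D} = 2 s(n) − s(n−D)`** for `n ≥ D`, `s(k) = binom(k+2, 2)`: here in the form
`dim + s(n − D) = 2 s(n)`. [cite: Roy2013, Lemma 5.1 (ii)] -/
theorem finrank_map_sup_map_of_le {P Q : CX} {D n : ℕ} (hP : P.IsHomogeneous D)
    (hQ : Q.IsHomogeneous D) (hP0 : P ≠ 0) (hQ0 : Q ≠ 0)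
    (hPQ : ∀ f : CX, Q * f ∈ Ideal.span {P} → f ∈ Ideal.span {P}) (hDn : D ≤ n) :
    finrank ℂ ↥((homogeneousSubmodule (Fin 3) ℂ n).map (LinearMap.mulLeft ℂ P) ⊔
        (homogeneousSubmodule (Fin 3) ℂ n).map (LinearMap.mulLeft ℂ Q)) + (n - D + 2).choose 2 =
      2 * (n + 2).choose 2 := by
  haveI := finite_homogeneousSubmodule_fin_three n
  haveI : FiniteDimensional ℂ ((homogeneousSubmodule (Fin 3) ℂ n).map (LinearMap.mulLeft ℂ P)) :=
    Module.Finite.map _ _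
  haveI : FiniteDimensional ℂ ((homogeneousSubmodule (Fin 3) ℂ n).map (LinearMap.mulLeft ℂ Q)) :=
    Module.Finite.map _ _
  have h := Submodule.finrank_sup_add_finrank_inf_eq
    ((homogeneousSubmodule (Fin 3) ℂ n).map (LinearMap.mulLeft ℂ P))
    ((homogeneousSubmodule (Fin 3) ℂ n).map (LinearMap.mulLeft ℂ Q))
  rw [map_mulLeft_inf_map_mulLeft_of_le hP hQ hPQ hDn, finrank_map_mulLeft (mul_ne_zero hP0 hQ0),
    finrank_map_mulLeft hP0, finrank_map_mulLeft hQ0] at h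
  omega

/-- The second difference of `s(k) = binom(k+2, 2)` with step `D` is `D²`. [folklore] -/
theorem choose_two_second_diff (n D : ℕ) :
    2 * (n + D + 2).choose 2 + D ^ 2 = (n + 2 * D + 2).choose 2 + (n + 2).choose 2 := by
  have h1 := two_mul_choose_two (n + D)
  have h2 := two_mul_choose_two (n + 2 * D)
  have h3 := two_mul_choose_two n
  nlinarith

/-- **`dim ℂ[X]_ν/(P, Q)_ν = D²` for `ν ≥ 2D`**, in the form `dim (P, Q)_ν + D² = s(ν)`
(`ν = n + 2D`). [cite: Roy2013, Lemma 5.1 (ii) and proof ("independent of `ν` for `ν ≥ …`")] -/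
theorem finrank_map_sup_map_add_sq {P Q : CX} {D : ℕ} (hP : P.IsHomogeneous D)
    (hQ : Q.IsHomogeneous D) (hP0 : P ≠ 0) (hQ0 : Q ≠ 0)
    (hPQ : ∀ f : CX, Q * f ∈ Ideal.span {P} → f ∈ Ideal.span {P}) (n : ℕ) :
    finrank ℂ ↥((homogeneousSubmodule (Fin 3) ℂ (n + D)).map (LinearMap.mulLeft ℂ P) ⊔
        (homogeneousSubmodule (Fin 3) ℂ (n + D)).map (LinearMap.mulLeft ℂ Q)) + D ^ 2 =
      (n + 2 * D + 2).choose 2 := by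
  have h := finrank_map_sup_map_of_le hP hQ hP0 hQ0 hPQ (Nat.le_add_left D n)
  rw [Nat.add_sub_cancel] at h
  have h2 := choose_two_second_diff n D
  have h3 : n + D + 2 = n + D + 2 := rfl
  omega

/-- The degree-`ν` part of `(P, Q)`, `ν = k + D`: forms of degree `ν` in `(P, Q)` are exactly the
`aP + bQ` with `a, b ∈ ℂ[X]_k`. [cite: Roy2013, §5, proof of Lemma 5.1] -/
theorem mem_map_sup_map_iff {P Q : CX} {D k : ℕ} (hP : P.IsHomogeneous D)
    (hQ : Q.IsHomogeneous D) {f : CX} :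
    f ∈ (homogeneousSubmodule (Fin 3) ℂ k).map (LinearMap.mulLeft ℂ P) ⊔
        (homogeneousSubmodule (Fin 3) ℂ k).map (LinearMap.mulLeft ℂ Q) ↔
      f.IsHomogeneous (k + D) ∧ f ∈ Ideal.span {P, Q} := by
  constructor
  · intro hf
    obtain ⟨_, ⟨a, ha, rfl⟩, _, ⟨b, hb, rfl⟩, rfl⟩ := Submodule.mem_sup.mp hf
    rw [LinearMap.mulLeft_apply, LinearMap.mulLeft_apply]
    refine ⟨?_, Ideal.mem_span_pair.mpr ⟨a, b, by ring⟩⟩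
    have h1 := hP.mul ha
    have h2 := hQ.mul hb
    rw [add_comm D k] at h1 h2
    exact h1.add h2
  · rintro ⟨hf, hfPQ⟩
    have h := mem_sup_of_mem_span_pair hP hQ (Nat.le_add_left D k) hf hfPQ
    rwa [Nat.add_sub_cancel] at h

/-! ### Points of `𝒵(P, Q)` impose independent conditions -/

/-- Two non-proportional non-zero vectors are separated by a linear form vanishing on the first.
[folklore] -/
theorem exists_linear_sep {α β : Fin 3 → ℂ} (hα : α ≠ 0) (h : ¬∃ t : ℂ, β = t • α) :
    ∃ l : CX, l.IsHomogeneous 1 ∧ eval α l = 0 ∧ eval β l ≠ 0 := by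
  -- some `2 × 2` minor is non-zero
  obtain ⟨k, hk⟩ : ∃ k, α k ≠ 0 := by
    by_contra h0
    exact hα (funext fun k => by simpa using not_exists.mp h0 k)
  obtain ⟨j, hj⟩ : ∃ j, α k * β j - α j * β k ≠ 0 := by
    by_contra h0
    refine h ⟨β k / α k, funext fun j => ?_⟩
    have h1 : α k * β j - α j * β k = 0 := by simpa using not_exists.mp h0 j
    rw [Pi.smul_apply, smul_eq_mul]
    field_simp
    linear_combination h1
  refine ⟨C (α k) * X j - C (α j) * X k, ((isHomogeneous_X ℂ j).C_mul _).sub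
    ((isHomogeneous_X ℂ k).C_mul _), ?_, ?_⟩
  · simp; ring
  · simpa using hj

/-- Interpolating forms: given pairwise non-proportional non-zero vectors `α₁, …, αₘ` and
`ν ≥ m − 1`, for each `j` a form of degree `ν` vanishing at the `αᵢ`, `i ≠ j`, but not at `αⱼ`.
[folklore] -/
theorem exists_interp_form {m : ℕ} (α : Fin m → (Fin 3 → ℂ)) (hα0 : ∀ i, α i ≠ 0)
    (hsep : ∀ i j, i ≠ j → ¬∃ t : ℂ, α j = t • α i) {ν : ℕ} (hν : m ≤ ν + 1) (j : Fin m) :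
    ∃ g : CX, g.IsHomogeneous ν ∧ (∀ i, i ≠ j → eval (α i) g = 0) ∧ eval (α j) g ≠ 0 := by
  classical
  have hl : ∀ i : Fin m, i ≠ j → ∃ l : CX, l.IsHomogeneous 1 ∧ eval (α i) l = 0 ∧ eval (α j) l ≠ 0 :=
    fun i hij => exists_linear_sep (hα0 i) (hsep i j hij)
  choose! l hlh hli hlj using hl
  obtain ⟨k, hk⟩ : ∃ k, α j k ≠ 0 := by
    by_contra h0
    exact hα0 j (funext fun k => by simpa using not_exists.mp h0 k)
  set s := (univ : Finset (Fin m)).erase j with hs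
  have hcard : s.card = m - 1 := by rw [hs, card_erase_of_mem (mem_univ j), card_univ, Fintype.card_fin]
  refine ⟨(∏ i ∈ s, l i) * X k ^ (ν - (m - 1)), ?_, ?_, ?_⟩
  · have h1 : (∏ i ∈ s, l i).IsHomogeneous (∑ i ∈ s, 1) :=
      IsHomogeneous.prod s l (fun _ => 1) fun i hi => hlh i (ne_of_mem_erase hi)
    rw [sum_const, smul_eq_mul, mul_one, hcard] at h1
    have h2 := h1.mul ((isHomogeneous_X ℂ k).pow (ν - (m - 1)))
    rwa [one_mul, Nat.add_sub_cancel' (by omega : m - 1 ≤ ν)] at h2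
  · intro i hij
    rw [map_mul, map_prod, prod_eq_zero (mem_erase.mpr ⟨hij, mem_univ i⟩) (hli i hij), zero_mul]
  · rw [map_mul, map_prod, map_pow, eval_X]
    exact mul_ne_zero (prod_ne_zero_iff.mpr fun i hi => hlj i (ne_of_mem_erase hi)) (pow_ne_zero _ hk)

/-- **`𝒵(P, Q)` has at most `D²` points**: pairwise non-proportional common zeros of two coprime
ternary forms of degree `D` number at most `D² = dim ℂ[X]_ν/(P, Q)_ν`.
[cite: Roy2013, §6, proof of Proposition 6.4 ("`𝒵(P, Q)` has dimension `0`"); Lemma 5.1 (ii)] -/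
theorem card_common_zeros_le {P Q : CX} {D : ℕ} (hP : P.IsHomogeneous D) (hQ : Q.IsHomogeneous D)
    (hP0 : P ≠ 0) (hQ0 : Q ≠ 0) (hPQ : ∀ f : CX, Q * f ∈ Ideal.span {P} → f ∈ Ideal.span {P})
    {m : ℕ} (α : Fin m → (Fin 3 → ℂ)) (hα0 : ∀ i, α i ≠ 0)
    (hsep : ∀ i j, i ≠ j → ¬∃ t : ℂ, α j = t • α i)
    (hαP : ∀ i, eval (α i) P = 0) (hαQ : ∀ i, eval (α i) Q = 0) : m ≤ D ^ 2 := by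
  classical
  -- work in degree `ν = m + 2D`
  set ν : ℕ := m + D + D with hν
  set V := homogeneousSubmodule (Fin 3) ℂ ν with hV
  set W := (homogeneousSubmodule (Fin 3) ℂ (m + D)).map (LinearMap.mulLeft ℂ P) ⊔
    (homogeneousSubmodule (Fin 3) ℂ (m + D)).map (LinearMap.mulLeft ℂ Q) with hW
  haveI : FiniteDimensional ℂ V := finite_homogeneousSubmodule_fin_three ν
  have hWV : W ≤ V := fun f hf => by
    have h := ((mem_map_sup_map_iff hP hQ).mp hf).1
    exact (mem_homogeneousSubmodule _ _).mpr h
  -- evaluation at the points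
  set E : CX →ₗ[ℂ] (Fin m → ℂ) := LinearMap.pi fun i => (MvPolynomial.aeval (α i)).toLinearMap
    with hE
  have hEapp : ∀ (f : CX) (i : Fin m), E f i = eval (α i) f := fun f i => rfl
  set Eν : V →ₗ[ℂ] (Fin m → ℂ) := E.comp V.subtype with hEν
  -- `Eν` is onto
  have hsurj : LinearMap.range Eν = ⊤ := by
    rw [eq_top_iff]
    rintro v -
    have hg : ∀ j : Fin m, ∃ g : CX, g.IsHomogeneous ν ∧ (∀ i, i ≠ j → eval (α i) g = 0) ∧
        eval (α j) g ≠ 0 := fun j => exists_interp_form α hα0 hsep (by omega) j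
    choose g hgh hgi hgj using hg
    refine ⟨∑ j, (v j / eval (α j) (g j)) • ⟨g j, (mem_homogeneousSubmodule _ _).mpr (hgh j)⟩, ?_⟩
    funext i
    rw [map_sum]
    simp only [map_smul, Finset.sum_apply, Pi.smul_apply, smul_eq_mul, hEν, LinearMap.comp_apply,
      Submodule.subtype_apply, hEapp]
    rw [Finset.sum_eq_single i (fun j _ hji => by rw [hgi j i (Ne.symm hji), mul_zero])
      (fun h => absurd (mem_univ i) h), div_mul_cancel₀ _ (hgj i)]
  -- `W ⊆ ker Eν`
  have hker : W.comap V.subtype ≤ LinearMap.ker Eν := by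
    intro f hf
    obtain ⟨-, hfPQ⟩ := (mem_map_sup_map_iff hP hQ).mp (Submodule.mem_comap.mp hf)
    obtain ⟨a, b, hab⟩ := Ideal.mem_span_pair.mp hfPQ
    rw [LinearMap.mem_ker]
    funext i
    rw [hEν, LinearMap.comp_apply, hEapp, Pi.zero_apply, ← hab, map_add, map_mul, map_mul, hαP i,
      hαQ i, mul_zero, mul_zero, add_zero]
  -- count dimensions
  have h1 := LinearMap.finrank_range_add_finrank_ker Eν
  rw [hsurj, finrank_top, Module.finrank_fintype_fun_eq_card, Fintype.card_fin] at h1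
  have h2 : finrank ℂ ↥(W.comap V.subtype) ≤ finrank ℂ ↥(LinearMap.ker Eν) :=
    Submodule.finrank_mono hker
  rw [LinearEquiv.finrank_eq (Submodule.comapSubtypeEquivOfLe hWV)] at h2
  have h3 := finrank_map_sup_map_add_sq hP hQ hP0 hQ0 hPQ m
  rw [← hW] at h3
  have h4 : finrank ℂ V = (m + 2 * D + 2).choose 2 := by
    rw [hV, finrank_homogeneousSubmodule_fin_three, hν]; ring_nf
  omega

/-- **A finite system of representatives of `𝒵(P, Q)`**: at most `D²` pairwise non-proportional
common zeros such that every common zero is proportional to one of them.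
[cite: Roy2013, §6, proof of Proposition 6.4 ("a system of representatives `α₁, …, α_t`")] -/
theorem exists_common_zero_reprs {P Q : CX} {D : ℕ} (hP : P.IsHomogeneous D)
    (hQ : Q.IsHomogeneous D) (hP0 : P ≠ 0) (hQ0 : Q ≠ 0)
    (hPQ : ∀ f : CX, Q * f ∈ Ideal.span {P} → f ∈ Ideal.span {P}) :
    ∃ (m : ℕ) (α : Fin m → (Fin 3 → ℂ)), m ≤ D ^ 2 ∧ (∀ i, α i ≠ 0) ∧
      (∀ i, eval (α i) P = 0 ∧ eval (α i) Q = 0) ∧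
      (∀ i j, i ≠ j → ¬∃ t : ℂ, α j = t • α i) ∧
      ∀ β : Fin 3 → ℂ, β ≠ 0 → eval β P = 0 → eval β Q = 0 → ∃ i, ∃ t : ℂ, β = t • α i := by
  classical
  -- families of pairwise non-proportional common zeros have bounded size; take a largest one
  let Good : ℕ → Prop := fun m => ∃ α : Fin m → (Fin 3 → ℂ), (∀ i, α i ≠ 0) ∧
    (∀ i, eval (α i) P = 0 ∧ eval (α i) Q = 0) ∧ (∀ i j, i ≠ j → ¬∃ t : ℂ, α j = t • α i)
  have hbound : ∀ m, Good m → m ≤ D ^ 2 := fun m ⟨α, h0, hz, hs⟩ =>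
    card_common_zeros_le hP hQ hP0 hQ0 hPQ α h0 hs (fun i => (hz i).1) (fun i => (hz i).2)
  have hgood0 : Good 0 := ⟨Fin.elim0, fun i => i.elim0, fun i => i.elim0, fun i => i.elim0⟩
  set m₀ := Nat.findGreatest Good (D ^ 2) with hm₀
  have hm₀good : Good m₀ := Nat.findGreatest_spec (Nat.zero_le (D ^ 2)) hgood0
  obtain ⟨α, h0, hz, hs⟩ := hm₀good
  refine ⟨m₀, α, Nat.findGreatest_le _, h0, hz, hs, fun β hβ hβP hβQ => ?_⟩
  by_contra hcov
  -- extend the family by `β`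
  have hgood' : Good (m₀ + 1) := by
    refine ⟨Fin.snoc α β, ?_, ?_, ?_⟩
    · intro i
      cases i using Fin.lastCases with
      | last => simpa using hβ
      | cast i => simpa using h0 i
    · intro i
      cases i using Fin.lastCases with
      | last => simpa using And.intro hβP hβQ
      | cast i => simpa using hz i
    · intro i j hij
      cases i using Fin.lastCases with
      | last =>
        cases j using Fin.lastCases with
        | last => exact absurd rfl hij
        | cast j' =>
          rintro ⟨t, ht⟩
          simp only [Fin.snoc_last, Fin.snoc_castSucc] at ht
          have ht0 : t ≠ 0 := fun h' => h0 j' (by rw [ht, h', zero_smul])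
          exact hcov ⟨j', t⁻¹, by rw [ht, smul_smul, inv_mul_cancel₀ ht0, one_smul]⟩
      | cast i' =>
        cases j using Fin.lastCases with
        | last =>
          rintro ⟨t, ht⟩
          simp only [Fin.snoc_last, Fin.snoc_castSucc] at ht
          exact hcov ⟨i', t, ht⟩
        | cast j' =>
          rintro ⟨t, ht⟩
          simp only [Fin.snoc_castSucc] at ht
          exact hs i' j' (fun h => hij (by rw [h])) ⟨t, ht⟩
  have h1 : m₀ + 1 ≤ D ^ 2 := hbound _ hgood'
  exact Nat.findGreatest_is_greatest (Nat.lt_succ_self m₀) h1 hgood'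

/-! ### A regular third form -/

/-- Avoiding finitely many points by a line `X₀ = aX₁ + bX₂`. [folklore] -/
theorem exists_lineForm_forall_eval_ne_zero {m : ℕ} (α : Fin m → (Fin 3 → ℂ)) (hα0 : ∀ i, α i ≠ 0) :
    ∃ a b : ℂ, ∀ i, eval (α i) (lineForm a b) ≠ 0 := by
  classical
  obtain ⟨a, ha⟩ := Infinite.exists_notMem_finset
    ((univ.filter fun i => α i 2 = 0).image fun i => α i 0 / α i 1)
  obtain ⟨b, hb⟩ := Infinite.exists_notMem_finset
    ((univ.filter fun i => α i 2 ≠ 0).image fun i => (α i 0 - a * α i 1) / α i 2)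
  refine ⟨a, b, fun i h => ?_⟩
  rw [eval_lineForm, sub_eq_zero] at h
  by_cases h2 : α i 2 = 0
  · by_cases h1 : α i 1 = 0
    · apply hα0 i
      funext k; fin_cases k
      · simpa [h1, h2] using h
      · exact h1
      · exact h2
    · apply ha
      rw [mem_image]
      refine ⟨i, mem_filter.mpr ⟨mem_univ i, h2⟩, ?_⟩
      rw [h, h2, mul_zero, add_zero, mul_div_cancel_right₀ _ h1]
  · apply hb
    rw [mem_image]
    refine ⟨i, mem_filter.mpr ⟨mem_univ i, h2⟩, ?_⟩
    rw [h]; field_simp; ring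

/-- **A regular third form.** For coprime ternary forms `P, Q` of degree `D ≥ 1` there are `a, b`
such that the line `X₀ = aX₁ + bX₂` avoids `𝒵(P, Q)`; then `h = X₀ − aX₁ − bX₂` and all its
powers are non-zero-divisors modulo `(P, Q)` — in particular `R₀ = h^D ∈ ℂ[X]_D` completes
`(P, Q)` to a regular sequence. [cite: Roy2013, §5 (regular sequences), Lemma 5.1 hypotheses] -/
theorem exists_regular_lineForm_pow {P Q : CX} {D : ℕ} (hP : P.IsHomogeneous D)
    (hQ : Q.IsHomogeneous D) (hD : 1 ≤ D) (hP0 : P ≠ 0) (hQ0 : Q ≠ 0)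
    (hPQ : ∀ f : CX, Q * f ∈ Ideal.span {P} → f ∈ Ideal.span {P}) :
    ∃ a b : ℂ, (∀ β : Fin 3 → ℂ, β ≠ 0 → eval β P = 0 → eval β Q = 0 →
        eval β (lineForm a b) ≠ 0) ∧
      ∀ (k : ℕ) (f : CX), lineForm a b ^ k * f ∈ Ideal.span {P, Q} → f ∈ Ideal.span {P, Q} := by
  obtain ⟨m, α, -, hα0, hz, -, hcov⟩ := exists_common_zero_reprs hP hQ hP0 hQ0 hPQ
  obtain ⟨a, b, hab⟩ := exists_lineForm_forall_eval_ne_zero α hα0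
  have hV : ∀ β : Fin 3 → ℂ, β ≠ 0 → eval β P = 0 → eval β Q = 0 →
      eval β (lineForm a b) ≠ 0 := by
    intro β hβ hβP hβQ
    obtain ⟨i, t, rfl⟩ := hcov β hβ hβP hβQ
    have ht : t ≠ 0 := fun h => hβ (by rw [h, zero_smul])
    have hlin : eval (t • α i) (lineForm a b) = t * eval (α i) (lineForm a b) := by
      rw [eval_lineForm, eval_lineForm]; simp only [Pi.smul_apply, smul_eq_mul]; ring
    rw [hlin]
    exact mul_ne_zero ht (hab i)
  exact ⟨a, b, hV, fun k f hf => lineForm_pow_mul_mem_span_pair a b hP hQ hD hV k hf⟩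

end Roy2013

end Literature.NumberTheory.Transcendental
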